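import Mathlib.Analysis.SpecialFunctions.Gamma.Beta
import Mathlib.Analysis.SpecialFunctions.Gamma.BohrMollerup
import Mathlib.Analysis.SpecialFunctions.Trigonometric.EulerSineProd
import Mathlib.Analysis.Complex.PhragmenLindelof
import Mathlib.Analysis.SpecialFunctions.Trigonometric.DerivHyp
import Mathlib.Tactic
import HarnessLib

/-!
# The Euler tail products `∏_{l>m} (1 - y²/l²)` and their uniform exponential-type bound

For `m ∈ ℕ` the tail of Euler's product for `sin(πy)/(πy)`,

  `G_m(y) = ∏_{l > m} (1 - y²/l²) = (m!)² / (Γ(m+1+y) Γ(m+1-y))`,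

is an entire function of `y` (we *define* it by the right-hand side, `Zagier2012.eulerTail`, using
Mathlib's `Complex.Gamma`, whose reciprocal is entire; `Zagier2012.tendsto_prod_eulerTail` recovers
it as the limit of the finite products, via `Complex.GammaSeq_tendsto_Gamma`). The main result of
this file is the bound, **uniform in `m`**,

  `‖G_m(y)‖ ≤ e^{π |Im y|}`   (`Zagier2012.norm_eulerTail_le`).

Proof: on the real axis `|G_m(s)| ≤ 1` (`Zagier2012.norm_eulerTail_real_le_one`: for `|s| < m+1`
by the log-convexity of `Γ` (Bohr–Mollerup, `Real.convexOn_log_Gamma`), for `|s| ≥ m+1` by the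
reflection formula); on the imaginary axis `|G_m(it)| ≤ sinh(πt)/(πt)`
(`Zagier2012.norm_eulerTail_mul_I_le`, from `|Γ(1+it)|² = πt/sinh(πt)`); globally
`|G_m(y)| ≤ e^π e^{π|y|}` (`Zagier2012.norm_eulerTail_le_exp`, from the product); hence the
Phragmén–Lindelöf principle in the two upper quadrants (`PhragmenLindelof.quadrant_I/II`) applied
to `G_m(z) e^{iπz}` gives `|G_m(z) e^{iπz}| ≤ 1` on the upper half-plane, and evenness finishes.

Purpose. This is the analytic input for the growth estimate of Zagier's generating function
`F(x, y) = -x²y ∑_m m^{-3} ∏_{k<m}(1 - x²/k²) · G_m(y)` of the multiple zeta values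
`ζ(2,…,2,3,2,…,2)` ([Zagier2012, (11) and Proposition 3]): it yields
`|F(x, y)| ≤ C_x |y| e^{π|Im y|}` for all `y`, uniformly, which replaces the estimate (18) of
[Zagier2012] (whose printed justification, `|(1-y)_m (1+y)_m| > m!²` for `|Im y| ≥ 2`, does not hold
uniformly in `Re y`). All statements here are classical analysis; no multiple zeta values occur.

## References
* [Zagier2012] D. Zagier, *Evaluation of the multiple zeta values ζ(2,…,2,3,2,…,2)*, Ann. of
  Math. 175 (2012), 977–1000, §2 (11)–(12) and Proposition 3.
-/

noncomputable section

open Finset Filter Topology Real Complex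

namespace Literature.NumberTheory.Transcendental

namespace Zagier2012

/-- The Euler tail product `G_m(y) = ∏_{l > m} (1 - y²/l²)`, defined as the entire function
`(m!)² / (Γ(m+1+y) Γ(m+1-y))`. [folklore] -/
def eulerTail (m : ℕ) (y : ℂ) : ℂ :=
  ((m.factorial : ℂ)) ^ 2 * (Complex.Gamma (m + 1 + y))⁻¹ * (Complex.Gamma (m + 1 - y))⁻¹

/-- `G_m` is entire. [folklore] -/
theorem differentiable_eulerTail (m : ℕ) : Differentiable ℂ (eulerTail m) := by
  unfold eulerTail
  refine ((differentiable_const _).mul ?_).mul ?_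
  · exact Complex.differentiable_one_div_Gamma.comp ((differentiable_const _).add differentiable_id)
  · exact Complex.differentiable_one_div_Gamma.comp ((differentiable_const _).sub differentiable_id)

/-- `G_m` is even. [folklore] -/
theorem eulerTail_neg (m : ℕ) (y : ℂ) : eulerTail m (-y) = eulerTail m y := by
  unfold eulerTail
  rw [sub_neg_eq_add, ← sub_eq_add_neg]
  ring

/-- `G_m(0) = 1`. [folklore] -/
@[simp] theorem eulerTail_zero_right (m : ℕ) : eulerTail m 0 = 1 := by
  unfold eulerTail
  rw [add_zero, sub_zero, Complex.Gamma_nat_eq_factorial]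
  have : ((m.factorial : ℂ)) ≠ 0 := by exact_mod_cast Nat.factorial_ne_zero m
  field_simp

/-- The finite products `∏_{j ≤ n} (1 - y²/(m+1+j)²)` in terms of `GammaSeq`. [folklore] -/
theorem prod_eq_div_GammaSeq (m : ℕ) (y : ℂ) {n : ℕ} (hn : n ≠ 0)
    (hu : ∀ j : ℕ, (m : ℂ) + 1 + y + j ≠ 0) (hv : ∀ j : ℕ, (m : ℂ) + 1 - y + j ≠ 0) :
    ∏ j ∈ Finset.range (n + 1), (1 - y ^ 2 / ((m : ℂ) + 1 + j) ^ 2) =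
      ((m.factorial : ℂ)) ^ 2 * (((n : ℂ) ^ (m + 1) * n.factorial / ((m + n + 1).factorial : ℂ)) ^ 2) /
        (Complex.GammaSeq (m + 1 + y) n * Complex.GammaSeq (m + 1 - y) n) := by
  have hPu : ∏ j ∈ Finset.range (n + 1), ((m : ℂ) + 1 + y + j) ≠ 0 :=
    Finset.prod_ne_zero_iff.2 fun j _ => hu j
  have hPv : ∏ j ∈ Finset.range (n + 1), ((m : ℂ) + 1 - y + j) ≠ 0 :=
    Finset.prod_ne_zero_iff.2 fun j _ => hv j
  have hn0 : (n : ℂ) ≠ 0 := by exact_mod_cast hn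
  have hGS : Complex.GammaSeq (m + 1 + y) n * Complex.GammaSeq (m + 1 - y) n =
      (n : ℂ) ^ (2 * m + 2) * (n.factorial : ℂ) ^ 2 /
        ((∏ j ∈ Finset.range (n + 1), ((m : ℂ) + 1 + y + j)) * ∏ j ∈ Finset.range (n + 1), ((m : ℂ) + 1 - y + j)) := by
    rw [Complex.GammaSeq, Complex.GammaSeq, div_mul_div_comm]
    congr 1
    rw [show (n : ℂ) ^ (2 * m + 2) = (n : ℂ) ^ ((m : ℂ) + 1 + y) * (n : ℂ) ^ ((m : ℂ) + 1 - y) by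
      rw [← Complex.cpow_add _ _ hn0, show (m : ℂ) + 1 + y + ((m : ℂ) + 1 - y) = ((2 * m + 2 : ℕ) : ℂ) by push_cast; ring,
        Complex.cpow_natCast]]
    ring
  -- the finite product
  have hprod : ∏ j ∈ Finset.range (n + 1), (1 - y ^ 2 / ((m : ℂ) + 1 + j) ^ 2) =
      ((∏ j ∈ Finset.range (n + 1), ((m : ℂ) + 1 + y + j)) * ∏ j ∈ Finset.range (n + 1), ((m : ℂ) + 1 - y + j)) /
        ∏ j ∈ Finset.range (n + 1), ((m : ℂ) + 1 + j) ^ 2 := by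
    rw [← Finset.prod_mul_distrib, ← Finset.prod_div_distrib]
    refine Finset.prod_congr rfl fun j _ => ?_
    have : ((m : ℂ) + 1 + j) ≠ 0 := by exact_mod_cast (show (m + 1 + j : ℕ) ≠ 0 by omega)
    field_simp
    ring
  have hfac : ∏ j ∈ Finset.range (n + 1), ((m : ℂ) + 1 + j) = ((m + n + 1).factorial : ℂ) / (m.factorial : ℂ) := by
    have hm : ((m.factorial : ℂ)) ≠ 0 := by exact_mod_cast Nat.factorial_ne_zero m
    rw [eq_div_iff hm]
    have key : ∀ n : ℕ, (m.factorial) * ∏ j ∈ Finset.range (n + 1), (m + 1 + j) = (m + n + 1).factorial := by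
      intro n
      induction n with
      | zero => rw [Finset.prod_range_one, add_zero, add_zero, Nat.factorial_succ]; ring
      | succ n ih =>
        rw [Finset.prod_range_succ, ← mul_assoc, ih, show m + (n + 1) + 1 = (m + n + 1) + 1 by ring,
          Nat.factorial_succ (m + n + 1)]
        ring
    have := congrArg (fun t : ℕ => (t : ℂ)) (key n)
    push_cast at this
    linear_combination this
  rw [hprod, hGS, Finset.prod_pow, hfac]
  have hm : ((m.factorial : ℂ)) ≠ 0 := by exact_mod_cast Nat.factorial_ne_zero m
  have hF : (((m + n + 1).factorial : ℂ)) ≠ 0 := by exact_mod_cast Nat.factorial_ne_zero _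
  have hnf : ((n.factorial : ℂ)) ≠ 0 := by exact_mod_cast Nat.factorial_ne_zero _
  have hnp : (n : ℂ) ^ (2 * m + 2) ≠ 0 := pow_ne_zero _ hn0
  field_simp
  ring

/-- `n^{m+1} n! / (m+n+1)! → 1`. [folklore] -/
theorem tendsto_pow_mul_factorial_div (m : ℕ) :
    Tendsto (fun n : ℕ => (n : ℂ) ^ (m + 1) * n.factorial / ((m + n + 1).factorial : ℂ)) atTop (𝓝 1) := by
  -- `= ∏_{l=1}^{m+1} n/(n+l)`
  have hr : ∀ n : ℕ, (n : ℂ) ^ (m + 1) * n.factorial / ((m + n + 1).factorial : ℂ) =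
      ∏ l ∈ Finset.range (m + 1), ((n : ℂ) / ((n : ℂ) + (l + 1))) := by
    intro n
    have key : ∀ m : ℕ, (m + n + 1).factorial = n.factorial * ∏ l ∈ Finset.range (m + 1), (n + (l + 1)) := by
      intro m
      induction m with
      | zero => rw [Finset.prod_range_one, zero_add, zero_add, Nat.factorial_succ]; ring
      | succ m ih =>
        rw [Finset.prod_range_succ, ← mul_assoc, ← ih, show m + 1 + n + 1 = (m + n + 1) + 1 by ring,
          Nat.factorial_succ (m + n + 1)]
        ring
    have key := key m
    rw [key, Finset.prod_div_distrib, Finset.prod_const, Finset.card_range]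
    push_cast
    have hnf : ((n.factorial : ℂ)) ≠ 0 := by exact_mod_cast Nat.factorial_ne_zero _
    have hP : ∏ l ∈ Finset.range (m + 1), ((n : ℂ) + (l + 1)) ≠ 0 :=
      Finset.prod_ne_zero_iff.2 fun l _ => by exact_mod_cast (show (n + (l + 1) : ℕ) ≠ 0 by omega)
    field_simp
  simp_rw [hr]
  have hl : ∀ l ∈ Finset.range (m + 1), Tendsto (fun n : ℕ => ((n : ℂ) / ((n : ℂ) + (l + 1)))) atTop (𝓝 1) := by
    intro l _
    have h := tendsto_natCast_div_add_atTop ((l : ℝ) + 1)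
    have hc := (Complex.continuous_ofReal.tendsto 1).comp h
    simp only [Function.comp_def, Complex.ofReal_one] at hc
    refine hc.congr fun n => ?_
    push_cast
    ring
  simpa using tendsto_finsetProd _ hl

/-- **The Euler tail product as a limit**: `∏_{j ≤ n} (1 - y²/(m+1+j)²) → G_m(y)`. [folklore] -/
theorem tendsto_prod_eulerTail (m : ℕ) (y : ℂ) :
    Tendsto (fun n : ℕ => ∏ j ∈ Finset.range (n + 1), (1 - y ^ 2 / ((m : ℂ) + 1 + j) ^ 2)) atTop
      (𝓝 (eulerTail m y)) := by
  by_cases hpole : ∃ j : ℕ, (m : ℂ) + 1 + y + j = 0 ∨ (m : ℂ) + 1 - y + j = 0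
  · -- at a zero of `G_m`: the products are eventually `0`, and `G_m(y) = 0`
    obtain ⟨j, hj⟩ := hpole
    have hy2 : y ^ 2 = ((m : ℂ) + 1 + j) ^ 2 := by
      rcases hj with h | h
      · have : y = -((m : ℂ) + 1 + j) := by linear_combination h
        rw [this]; ring
      · have : y = (m : ℂ) + 1 + j := by linear_combination -h
        rw [this]
    have hG : eulerTail m y = 0 := by
      unfold eulerTail
      rcases hj with h | h
      · have : (m : ℂ) + 1 + y = -(j : ℂ) := by linear_combination h
        rw [this, Complex.Gamma_neg_nat_eq_zero]; simp
      · have : (m : ℂ) + 1 - y = -(j : ℂ) := by linear_combination h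
        rw [this, Complex.Gamma_neg_nat_eq_zero]; simp
    rw [hG]
    apply tendsto_const_nhds.congr'
    filter_upwards [Filter.eventually_ge_atTop j] with n hn
    symm
    apply Finset.prod_eq_zero (Finset.mem_range.2 (by omega : j < n + 1))
    rw [hy2]
    have : ((m : ℂ) + 1 + j) ≠ 0 := by exact_mod_cast (show (m + 1 + j : ℕ) ≠ 0 by omega)
    field_simp
    ring
  · push Not at hpole
    have hu : ∀ j : ℕ, (m : ℂ) + 1 + y + j ≠ 0 := fun j => (hpole j).1
    have hv : ∀ j : ℕ, (m : ℂ) + 1 - y + j ≠ 0 := fun j => (hpole j).2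
    have hΓu : Complex.Gamma (m + 1 + y) ≠ 0 := by
      refine Complex.Gamma_ne_zero fun j h => hu j ?_
      rw [h]; ring
    have hΓv : Complex.Gamma (m + 1 - y) ≠ 0 := by
      refine Complex.Gamma_ne_zero fun j h => hv j ?_
      rw [h]; ring
    have hlim : Tendsto (fun n : ℕ => ((m.factorial : ℂ)) ^ 2 *
        (((n : ℂ) ^ (m + 1) * n.factorial / ((m + n + 1).factorial : ℂ)) ^ 2) /
          (Complex.GammaSeq (m + 1 + y) n * Complex.GammaSeq (m + 1 - y) n)) atTop (𝓝 (eulerTail m y)) := by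
      have h1 := ((tendsto_pow_mul_factorial_div m).pow 2).const_mul (((m.factorial : ℂ)) ^ 2)
      have h2 := (Complex.GammaSeq_tendsto_Gamma (m + 1 + y)).mul (Complex.GammaSeq_tendsto_Gamma (m + 1 - y))
      have h3 := h1.div h2 (mul_ne_zero hΓu hΓv)
      rw [one_pow, mul_one] at h3
      have he : ((m.factorial : ℂ)) ^ 2 / (Complex.Gamma (m + 1 + y) * Complex.Gamma (m + 1 - y)) = eulerTail m y := by
        unfold eulerTail
        field_simp
      rw [he] at h3
      exact h3
    refine hlim.congr' ?_
    filter_upwards [Filter.eventually_ge_atTop 1] with n hn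
    exact (prod_eq_div_GammaSeq m y (by omega) hu hv).symm

/-! ### A crude global bound `‖G_m(y)‖ ≤ e^π · e^{π ‖y‖}` -/

/-- Euler's product at an imaginary argument: `∏_{j<n} (1 + a²/(j+1)²) → sinh(πa)/(πa)` (`a ≠ 0`). [folklore] -/
theorem tendsto_prod_one_add_sq_div {a : ℝ} (ha : a ≠ 0) :
    Tendsto (fun n : ℕ => ∏ j ∈ Finset.range n, (1 + a ^ 2 / ((j : ℝ) + 1) ^ 2)) atTop
      (𝓝 (Real.sinh (π * a) / (π * a))) := by
  have h := Complex.tendsto_euler_sin_prod (a * I)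
  have hπa : (π : ℂ) * (a * I) ≠ 0 := by
    apply mul_ne_zero (by exact_mod_cast Real.pi_ne_zero) (mul_ne_zero (by exact_mod_cast ha) I_ne_zero)
  have h2 : Tendsto (fun n : ℕ => ∏ j ∈ Finset.range n, ((1 : ℂ) - (a * I) ^ 2 / ((j : ℂ) + 1) ^ 2)) atTop
      (𝓝 (Complex.sin (π * (a * I)) / (π * (a * I)))) := by
    have := h.div_const ((π : ℂ) * (a * I))
    refine this.congr fun n => ?_
    rw [mul_div_cancel_left₀ _ hπa]
  have hlim : Complex.sin (π * (a * I)) / (π * (a * I)) = ((Real.sinh (π * a) / (π * a) : ℝ) : ℂ) := by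
    rw [show (π : ℂ) * (a * I) = ((π * a : ℝ) : ℂ) * I by push_cast; ring, Complex.sin_mul_I,
      ← Complex.ofReal_sinh]
    have hI : (I : ℂ) ≠ 0 := I_ne_zero
    have hπa' : ((π * a : ℝ) : ℂ) ≠ 0 := by exact_mod_cast mul_ne_zero Real.pi_ne_zero ha
    rw [mul_div_mul_right _ _ hI]
    push_cast
    rfl
  rw [hlim] at h2
  have h3 := (Complex.continuous_re.tendsto _).comp h2
  simp only [Function.comp_def, Complex.ofReal_re] at h3
  refine h3.congr fun n => ?_
  rw [show (∏ j ∈ Finset.range n, ((1 : ℂ) - (a * I) ^ 2 / ((j : ℂ) + 1) ^ 2)) =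
    ((∏ j ∈ Finset.range n, (1 + a ^ 2 / ((j : ℝ) + 1) ^ 2) : ℝ) : ℂ) by
    push_cast
    refine Finset.prod_congr rfl fun j _ => ?_
    rw [mul_pow, Complex.I_sq]
    ring]
  exact Complex.ofReal_re _

/-- `∏_{j<n} (1 + a²/(j+1)²) ≤ e^π e^{πa}` for `a ≥ 0`. [folklore] -/
theorem prod_one_add_sq_div_le {a : ℝ} (ha : 0 ≤ a) (n : ℕ) :
    ∏ j ∈ Finset.range n, (1 + a ^ 2 / ((j : ℝ) + 1) ^ 2) ≤ Real.exp π * Real.exp (π * a) := by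
  -- compare with `a' = max a 1`
  set a' := max a 1 with ha'
  have h1 : 1 ≤ a' := le_max_right _ _
  have haa : a ≤ a' := le_max_left _ _
  have hmono : ∏ j ∈ Finset.range n, (1 + a ^ 2 / ((j : ℝ) + 1) ^ 2) ≤
      ∏ j ∈ Finset.range n, (1 + a' ^ 2 / ((j : ℝ) + 1) ^ 2) := by
    apply Finset.prod_le_prod
    · intro j _; positivity
    · intro j _
      gcongr
  -- the latter is bounded by its limit `sinh(π a')/(π a')`
  have hM : Monotone (fun n : ℕ => ∏ j ∈ Finset.range n, (1 + a' ^ 2 / ((j : ℝ) + 1) ^ 2)) := by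
    refine monotone_nat_of_le_succ fun n => ?_
    rw [Finset.prod_range_succ]
    refine le_mul_of_one_le_right (Finset.prod_nonneg fun j _ => by positivity) ?_
    have : 0 ≤ a' ^ 2 / ((n : ℝ) + 1) ^ 2 := by positivity
    linarith
  have hle := hM.ge_of_tendsto (tendsto_prod_one_add_sq_div (by linarith : a' ≠ 0)) n
  refine hmono.trans (hle.trans ?_)
  -- `sinh(π a')/(π a') ≤ e^{π a'} ≤ e^π e^{π a}`
  have hπa : 0 < π * a' := by positivity
  have hs : Real.sinh (π * a') ≤ Real.exp (π * a') := by
    rw [Real.sinh_eq]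
    have := Real.exp_pos (-(π * a'))
    have := Real.exp_pos (π * a')
    linarith
  have h3 : Real.sinh (π * a') / (π * a') ≤ Real.exp (π * a') := by
    rw [div_le_iff₀ hπa]
    have : 1 ≤ π * a' := by nlinarith [Real.two_le_pi]
    nlinarith [Real.exp_pos (π * a')]
  refine h3.trans ?_
  rw [← Real.exp_add]
  apply Real.exp_le_exp.2
  rcases le_or_gt a 1 with h | h
  · rw [ha', max_eq_right h]; nlinarith [Real.pi_pos]
  · rw [ha', max_eq_left h.le]; nlinarith [Real.pi_pos]

/-- **Crude global bound**: `‖G_m(y)‖ ≤ e^π e^{π ‖y‖}`. [folklore] -/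
theorem norm_eulerTail_le_exp (m : ℕ) (y : ℂ) :
    ‖eulerTail m y‖ ≤ Real.exp π * Real.exp (π * ‖y‖) := by
  have hlim := (tendsto_prod_eulerTail m y).norm
  refine le_of_tendsto' hlim fun n => ?_
  rw [norm_prod]
  calc ∏ j ∈ Finset.range (n + 1), ‖(1 : ℂ) - y ^ 2 / ((m : ℂ) + 1 + j) ^ 2‖
      ≤ ∏ j ∈ Finset.range (n + 1), (1 + ‖y‖ ^ 2 / (((m + j : ℕ) : ℝ) + 1) ^ 2) := by
        apply Finset.prod_le_prod (fun j _ => norm_nonneg _) fun j _ => ?_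
        refine (norm_sub_le _ _).trans ?_
        rw [norm_one, norm_div, norm_pow, norm_pow]
        gcongr
        apply le_of_eq
        rw [show ((m : ℂ) + 1 + j) = (((m + j : ℕ) : ℝ) + 1 : ℝ) by push_cast; ring, Complex.norm_real,
          Real.norm_eq_abs, abs_of_pos (by positivity)]
    _ ≤ ∏ l ∈ Finset.range (m + (n + 1)), (1 + ‖y‖ ^ 2 / ((l : ℝ) + 1) ^ 2) := by
        conv_rhs => rw [Finset.prod_range_add]
        push_cast
        refine le_mul_of_one_le_left (Finset.prod_nonneg fun j _ => by positivity) ?_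
        calc (1 : ℝ) = ∏ l ∈ Finset.range m, 1 := by simp
          _ ≤ ∏ l ∈ Finset.range m, (1 + ‖y‖ ^ 2 / ((l : ℝ) + 1) ^ 2) := by
              apply Finset.prod_le_prod (fun l _ => zero_le_one) fun l _ => ?_
              have : 0 ≤ ‖y‖ ^ 2 / ((l : ℝ) + 1) ^ 2 := by positivity
              linarith
    _ ≤ Real.exp π * Real.exp (π * ‖y‖) := prod_one_add_sq_div_le (norm_nonneg y) _

/-! ### The real axis: `‖G_m(s)‖ ≤ 1` -/

/-- `Γ(x + k) = Γ(x) ∏_{j<k} (x + j)` for `x > 0`. [folklore] -/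
theorem Real_Gamma_add_nat {x : ℝ} (hx : 0 < x) (k : ℕ) :
    Real.Gamma (x + k) = Real.Gamma x * ∏ j ∈ Finset.range k, (x + j) := by
  induction k with
  | zero => simp
  | succ k ih =>
    rw [Finset.prod_range_succ, ← mul_assoc, ← ih, show x + ((k + 1 : ℕ) : ℝ) = (x + k) + 1 by push_cast; ring,
      Real.Gamma_add_one (by positivity)]
    ring

/-- The value of `G_m` at a real point. [folklore] -/
theorem eulerTail_ofReal (m : ℕ) (s : ℝ) :
    eulerTail m s = (((m.factorial : ℝ)) ^ 2 / (Real.Gamma (m + 1 + s) * Real.Gamma (m + 1 - s)) : ℝ) := by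
  unfold eulerTail
  rw [show (m : ℂ) + 1 + s = ((m + 1 + s : ℝ) : ℂ) by push_cast; ring,
    show (m : ℂ) + 1 - s = ((m + 1 - s : ℝ) : ℂ) by push_cast; ring, Complex.Gamma_ofReal, Complex.Gamma_ofReal]
  push_cast
  ring

/-- `(m!)² ≤ (2m+1)!`. [folklore] -/
theorem factorial_sq_le (m : ℕ) : (m.factorial) ^ 2 ≤ (2 * m + 1).factorial := by
  have h1 : m.factorial * m.factorial ≤ (m + m).factorial :=
    Nat.le_of_dvd (Nat.factorial_pos _) (Nat.factorial_mul_factorial_dvd_factorial_add m m)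
  have h2 : (m + m).factorial ≤ (2 * m + 1).factorial := Nat.factorial_le (by omega)
  rw [sq]; exact h1.trans h2

/-- **Real axis, inside**: for `|s| < m + 1`, `0 ≤ G_m(s) ≤ 1` (log-convexity of `Γ`). [folklore] -/
theorem eulerTail_real_le_one_of_abs_lt (m : ℕ) {s : ℝ} (hs : |s| < m + 1) :
    ((m.factorial : ℝ)) ^ 2 / (Real.Gamma (m + 1 + s) * Real.Gamma (m + 1 - s)) ≤ 1 := by
  have hu : 0 < (m : ℝ) + 1 + s := by have := neg_abs_le s; linarith
  have hv : 0 < (m : ℝ) + 1 - s := by have := le_abs_self s; linarith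
  have hΓu := Real.Gamma_pos_of_pos hu
  have hΓv := Real.Gamma_pos_of_pos hv
  rw [div_le_one (mul_pos hΓu hΓv)]
  -- log-convexity
  have hc := Real.convexOn_log_Gamma.2 hu hv (by norm_num : (0 : ℝ) ≤ 1 / 2) (by norm_num : (0 : ℝ) ≤ 1 / 2)
    (by norm_num)
  simp only [Function.comp_apply, smul_eq_mul] at hc
  rw [show 1 / 2 * ((m : ℝ) + 1 + s) + 1 / 2 * ((m : ℝ) + 1 - s) = (m : ℝ) + 1 by ring,
    show ((m : ℝ) + 1) = ((m : ℕ) : ℝ) + 1 by rfl, Real.Gamma_nat_eq_factorial] at hc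
  have h2 : Real.log (((m.factorial : ℝ)) ^ 2) ≤ Real.log (Real.Gamma (m + 1 + s) * Real.Gamma (m + 1 - s)) := by
    rw [Real.log_pow, Real.log_mul hΓu.ne' hΓv.ne']
    push_cast
    linarith
  exact (Real.log_le_log_iff (by positivity) (mul_pos hΓu hΓv)).1 h2

/-- **Real axis, outside**: for `s ≥ m + 1`, `|G_m(s)| ≤ 1` (reflection formula). [folklore] -/
theorem eulerTail_real_abs_le_one_of_le (m : ℕ) {s : ℝ} (hs : (m : ℝ) + 1 ≤ s) :
    |((m.factorial : ℝ)) ^ 2 / (Real.Gamma (m + 1 + s) * Real.Gamma (m + 1 - s))| ≤ 1 := by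
  by_cases hz : Real.Gamma (m + 1 - s) = 0
  · rw [hz]; simp
  have hsm : 0 < s - m := by linarith
  have hrefl := Real.Gamma_mul_Gamma_one_sub (s - m)
  rw [show 1 - (s - m) = (m : ℝ) + 1 - s by ring] at hrefl
  have hΓsm := Real.Gamma_pos_of_pos hsm
  have hsin : Real.sin (π * (s - m)) ≠ 0 := by
    intro h0
    rw [h0, div_zero] at hrefl
    rcases mul_eq_zero.1 hrefl with h | h
    · exact hΓsm.ne' h
    · exact hz h
  -- `Γ(m+1-s) = π / (sin(π(s-m)) Γ(s-m))`
  have hv : Real.Gamma (m + 1 - s) = π / (Real.sin (π * (s - m)) * Real.Gamma (s - m)) := by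
    rw [eq_div_iff (mul_ne_zero hsin hΓsm.ne')]
    have h2 := (div_eq_iff hsin).1 hrefl.symm
    linear_combination (-1 : ℝ) * h2
  -- `Γ(m+1+s) = Γ(s-m) ∏_{j<2m+1} (s-m+j) ≥ Γ(s-m) (2m+1)!`
  have hu : Real.Gamma (m + 1 + s) = Real.Gamma (s - m) * ∏ j ∈ Finset.range (2 * m + 1), (s - m + j) := by
    rw [← Real_Gamma_add_nat hsm]
    congr 1
    push_cast
    ring
  have hprod : ((2 * m + 1).factorial : ℝ) ≤ ∏ j ∈ Finset.range (2 * m + 1), (s - m + j) := by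
    rw [← Finset.prod_range_add_one_eq_factorial, Nat.cast_prod]
    apply Finset.prod_le_prod
    · intro j _; positivity
    · intro j _; push_cast; linarith
  have hupos : 0 < Real.Gamma (m + 1 + s) := Real.Gamma_pos_of_pos (by linarith)
  rw [hv, abs_div, abs_of_nonneg (by positivity), div_le_one (by
    rw [abs_pos]; exact mul_ne_zero hupos.ne' (by rw [← hv]; exact hz))]
  rw [abs_mul, abs_of_pos hupos, abs_div, abs_of_pos Real.pi_pos, abs_mul, abs_of_pos hΓsm]
  -- goal: (m!)² ≤ Γ(m+1+s) · (π / (|sin| Γ(s-m)))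
  have hsin1 : |Real.sin (π * (s - m))| ≤ 1 := Real.abs_sin_le_one _
  have hsinpos : 0 < |Real.sin (π * (s - m))| := abs_pos.2 hsin
  rw [hu]
  have hfac : ((m.factorial : ℝ)) ^ 2 ≤ ((2 * m + 1).factorial : ℝ) := by exact_mod_cast factorial_sq_le m
  calc ((m.factorial : ℝ)) ^ 2 ≤ ((2 * m + 1).factorial : ℝ) := hfac
    _ ≤ ∏ j ∈ Finset.range (2 * m + 1), (s - m + j) := hprod
    _ = (Real.Gamma (s - m) * ∏ j ∈ Finset.range (2 * m + 1), (s - m + j)) * (1 / Real.Gamma (s - m)) := by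
        field_simp
    _ ≤ (Real.Gamma (s - m) * ∏ j ∈ Finset.range (2 * m + 1), (s - m + j)) *
          (π / (|Real.sin (π * (s - m))| * Real.Gamma (s - m))) := by
        apply mul_le_mul_of_nonneg_left _ (by rw [← hu]; exact hupos.le)
        rw [div_le_div_iff₀ hΓsm (mul_pos hsinpos hΓsm)]
        nlinarith [Real.two_le_pi, hΓsm, mul_pos hsinpos hΓsm]

/-- **`‖G_m(s)‖ ≤ 1` for real `s`.** [folklore] -/
theorem norm_eulerTail_real_le_one (m : ℕ) (s : ℝ) : ‖eulerTail m s‖ ≤ 1 := by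
  -- reduce to `s ≥ 0` by evenness
  wlog hs0 : 0 ≤ s generalizing s
  · have := this (-s) (by linarith)
    rwa [Complex.ofReal_neg, eulerTail_neg] at this
  rw [eulerTail_ofReal, Complex.norm_real, Real.norm_eq_abs]
  rcases lt_or_ge s ((m : ℝ) + 1) with h | h
  · rw [abs_of_nonneg]
    · exact eulerTail_real_le_one_of_abs_lt m (by rw [abs_of_nonneg hs0]; exact h)
    · apply div_nonneg (by positivity)
      apply mul_nonneg (Real.Gamma_pos_of_pos (by linarith)).le (Real.Gamma_pos_of_pos (by linarith)).le
  · exact eulerTail_real_abs_le_one_of_le m h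

/-! ### The imaginary axis: `‖G_m(it)‖ e^{-π t} ≤ 1` for `t ≥ 0` -/

/-- `Γ(s + k) = Γ(s) ∏_{j<k} (s + j)` (complex, away from the poles). [folklore] -/
theorem Complex_Gamma_add_nat {s : ℂ} (hs : ∀ j : ℕ, s + j ≠ 0) (k : ℕ) :
    Complex.Gamma (s + k) = Complex.Gamma s * ∏ j ∈ Finset.range k, (s + j) := by
  induction k with
  | zero => simp
  | succ k ih =>
    rw [Finset.prod_range_succ, ← mul_assoc, ← ih, show s + ((k + 1 : ℕ) : ℂ) = (s + k) + 1 by push_cast; ring,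
      Complex.Gamma_add_one _ (hs k)]
    ring

/-- `‖Γ(1 + it)‖² = π t / sinh(π t)` for real `t ≠ 0`. [folklore] -/
theorem normSq_Gamma_one_add_mul_I {t : ℝ} (ht : t ≠ 0) :
    ‖Complex.Gamma (1 + t * I)‖ ^ 2 = π * t / Real.sinh (π * t) := by
  have hit : (t : ℂ) * I ≠ 0 := mul_ne_zero (by exact_mod_cast ht) I_ne_zero
  have h1 : Complex.Gamma (1 + t * I) = t * I * Complex.Gamma (t * I) := by
    rw [add_comm, Complex.Gamma_add_one _ hit]
  have hrefl := Complex.Gamma_mul_Gamma_one_sub (t * I)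
  have hconj : Complex.Gamma (1 - t * I) = (starRingEnd ℂ) (Complex.Gamma (1 + t * I)) := by
    rw [← Complex.Gamma_conj]
    congr 1
    simp [Complex.ext_iff]
  have hnorm : ((‖Complex.Gamma (1 + t * I)‖ ^ 2 : ℝ) : ℂ) = Complex.Gamma (1 + t * I) * Complex.Gamma (1 - t * I) := by
    rw [hconj, Complex.mul_conj, Complex.normSq_eq_norm_sq]
  have hsin : Complex.sin (π * (t * I)) = Real.sinh (π * t) * I := by
    rw [show (π : ℂ) * (t * I) = ((π * t : ℝ) : ℂ) * I by push_cast; ring, Complex.sin_mul_I,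
      ← Complex.ofReal_sinh]
  have hsinh : Real.sinh (π * t) ≠ 0 := by
    rcases lt_or_gt_of_ne ht with h | h
    · exact (Real.sinh_neg_iff.2 (by nlinarith [Real.pi_pos])).ne
    · exact (Real.sinh_pos_iff.2 (by positivity)).ne'
  apply Complex.ofReal_injective
  rw [hnorm, h1, mul_assoc, hrefl, hsin]
  push_cast
  field_simp

/-- **Imaginary axis**: `‖G_m(it)‖ ≤ sinh(πt)/(πt)` for `t ≠ 0`. [folklore] -/
theorem norm_eulerTail_mul_I_le (m : ℕ) {t : ℝ} (ht : t ≠ 0) :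
    ‖eulerTail m (t * I)‖ ≤ Real.sinh (π * t) / (π * t) := by
  have hs : ∀ j : ℕ, (1 : ℂ) + t * I + j ≠ 0 := by
    intro j h
    have := congrArg Complex.re h
    simp at this
    linarith
  have hG : Complex.Gamma ((m : ℂ) + 1 + t * I) = Complex.Gamma (1 + t * I) * ∏ j ∈ Finset.range m, (1 + t * I + j) := by
    rw [show (m : ℂ) + 1 + t * I = (1 + t * I) + m by ring]
    exact Complex_Gamma_add_nat hs m
  have hconj : Complex.Gamma ((m : ℂ) + 1 - t * I) = (starRingEnd ℂ) (Complex.Gamma ((m : ℂ) + 1 + t * I)) := by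
    rw [← Complex.Gamma_conj]
    congr 1
    simp [Complex.ext_iff]
  have hnormG : ‖Complex.Gamma ((m : ℂ) + 1 + t * I)‖ ≥ ‖Complex.Gamma (1 + t * I)‖ * m.factorial := by
    rw [hG, norm_mul, norm_prod]
    apply mul_le_mul_of_nonneg_left _ (norm_nonneg _)
    rw [← Finset.prod_range_add_one_eq_factorial, Nat.cast_prod]
    apply Finset.prod_le_prod
    · intro j _; positivity
    · intro j _
      calc ((j + 1 : ℕ) : ℝ) = |((1 : ℂ) + t * I + j).re| := by
            simp
            rw [abs_of_pos (by positivity)]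
            ring
        _ ≤ ‖(1 : ℂ) + t * I + j‖ := Complex.abs_re_le_norm _
  have hΓ1 : 0 < ‖Complex.Gamma (1 + t * I)‖ := by
    rw [norm_pos_iff]
    exact Complex.Gamma_ne_zero_of_re_pos (by simp)
  have hsq := normSq_Gamma_one_add_mul_I ht
  have hsinh_pos : 0 < Real.sinh (π * t) / (π * t) := by
    rcases lt_or_gt_of_ne ht with h | h
    · have : π * t < 0 := by nlinarith [Real.pi_pos]
      have h2 : Real.sinh (π * t) < 0 := Real.sinh_neg_iff.2 this
      exact div_pos_of_neg_of_neg h2 this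
    · have : 0 < π * t := by positivity
      exact div_pos (Real.sinh_pos_iff.2 this) this
  unfold eulerTail
  rw [norm_mul, norm_mul, norm_inv, norm_inv, hconj, Complex.norm_conj, norm_pow, Complex.norm_natCast]
  -- `(m!)² / ‖Γ‖² ≤ 1/‖Γ(1+it)‖² = sinh/(π t)`
  have hm : (0 : ℝ) < m.factorial := by exact_mod_cast Nat.factorial_pos m
  have hΓm : 0 < ‖Complex.Gamma ((m : ℂ) + 1 + t * I)‖ := by
    rw [norm_pos_iff]
    exact Complex.Gamma_ne_zero_of_re_pos (by simp; positivity)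
  have key : ((m.factorial : ℝ)) ^ 2 / ‖Complex.Gamma ((m : ℂ) + 1 + t * I)‖ ^ 2 ≤ 1 / ‖Complex.Gamma (1 + t * I)‖ ^ 2 := by
    rw [div_le_div_iff₀ (by positivity) (by positivity), one_mul]
    calc ((m.factorial : ℝ)) ^ 2 * ‖Complex.Gamma (1 + ↑t * I)‖ ^ 2
        = (‖Complex.Gamma (1 + ↑t * I)‖ * m.factorial) ^ 2 := by ring
      _ ≤ ‖Complex.Gamma ((m : ℂ) + 1 + t * I)‖ ^ 2 := by
          gcongr
  calc ((m.factorial : ℝ)) ^ 2 * ‖Complex.Gamma ((m : ℂ) + 1 + t * I)‖⁻¹ * ‖Complex.Gamma ((m : ℂ) + 1 + t * I)‖⁻¹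
      = ((m.factorial : ℝ)) ^ 2 / ‖Complex.Gamma ((m : ℂ) + 1 + t * I)‖ ^ 2 := by ring
    _ ≤ 1 / ‖Complex.Gamma (1 + t * I)‖ ^ 2 := key
    _ = Real.sinh (π * t) / (π * t) := by rw [hsq, one_div, inv_div]

/-- `sinh(πt)/(πt) · e^{-πt} ≤ 1` for `t > 0`. [folklore] -/
theorem sinh_div_mul_exp_neg_le_one {t : ℝ} (ht : 0 < t) :
    Real.sinh (π * t) / (π * t) * Real.exp (-(π * t)) ≤ 1 := by
  have hπt : 0 < π * t := by positivity
  rw [Real.sinh_eq, div_mul_eq_mul_div, div_le_one hπt]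
  have h1 : (Real.exp (π * t) - Real.exp (-(π * t))) / 2 * Real.exp (-(π * t)) = (1 - Real.exp (-(2 * (π * t)))) / 2 := by
    rw [show -(2 * (π * t)) = -(π * t) + -(π * t) by ring, Real.exp_add]
    have : Real.exp (π * t) * Real.exp (-(π * t)) = 1 := by rw [← Real.exp_add]; simp
    nlinarith [this]
  rw [h1]
  have h2 : 1 - 2 * (π * t) ≤ Real.exp (-(2 * (π * t))) := by
    have := Real.add_one_le_exp (-(2 * (π * t))); linarith
  linarith

/-! ### Phragmén–Lindelöf: `‖G_m(y)‖ ≤ e^{π |Im y|}` -/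

/-- The auxiliary function `h(z) = G_m(z) e^{iπz}` is bounded by `1` on the closed upper
half-plane (Phragmén–Lindelöf in the two upper quadrants). [folklore] -/
theorem norm_eulerTail_mul_exp_le_one (m : ℕ) {z : ℂ} (hz : 0 ≤ z.im) :
    ‖eulerTail m z * Complex.exp (I * π * z)‖ ≤ 1 := by
  set h : ℂ → ℂ := fun z => eulerTail m z * Complex.exp (I * π * z) with hh
  have hdiff : Differentiable ℂ h :=
    (differentiable_eulerTail m).mul (((differentiable_const _).mul differentiable_id).cexp)
  -- growth
  have hgrowth : ∀ z : ℂ, ‖h z‖ ≤ Real.exp π * ‖Real.exp (2 * π * ‖z‖ ^ (1 : ℝ))‖ := by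
    intro z
    rw [Real.rpow_one, Real.norm_eq_abs, abs_of_pos (Real.exp_pos _), hh]
    simp only [norm_mul]
    have h1 := norm_eulerTail_le_exp m z
    have h2 : ‖Complex.exp (I * π * z)‖ ≤ Real.exp (π * ‖z‖) := by
      rw [Complex.norm_exp]
      apply Real.exp_le_exp.2
      refine (Complex.re_le_norm _).trans ?_
      rw [norm_mul, norm_mul, Complex.norm_I, one_mul, Complex.norm_real, Real.norm_eq_abs,
        abs_of_pos Real.pi_pos]
    calc ‖eulerTail m z‖ * ‖Complex.exp (I * π * z)‖
        ≤ (Real.exp π * Real.exp (π * ‖z‖)) * Real.exp (π * ‖z‖) :=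
          mul_le_mul h1 h2 (norm_nonneg _) (by positivity)
      _ = Real.exp π * Real.exp (2 * π * ‖z‖) := by
          rw [mul_assoc, ← Real.exp_add]; ring_nf
  have hB : ∀ F : Filter ℂ, ∃ c < (2 : ℝ), ∃ B, h =O[F] fun z => Real.exp (B * ‖z‖ ^ c) :=
    fun F => ⟨1, by norm_num, 2 * π, Asymptotics.IsBigO.of_bound (Real.exp π) (Filter.Eventually.of_forall hgrowth)⟩
  -- boundary values
  have hre : ∀ x : ℝ, ‖h x‖ ≤ 1 := by
    intro x
    rw [hh]
    simp only [norm_mul]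
    rw [show I * (π : ℂ) * (x : ℂ) = ((π * x : ℝ) : ℂ) * I by push_cast; ring, Complex.norm_exp_ofReal_mul_I,
      mul_one]
    exact norm_eulerTail_real_le_one m x
  have him : ∀ x : ℝ, 0 ≤ x → ‖h (x * I)‖ ≤ 1 := by
    intro x hx
    rw [hh]
    simp only [norm_mul]
    rw [show I * (π : ℂ) * ((x : ℂ) * I) = ((-(π * x) : ℝ) : ℂ) by
      push_cast; ring_nf; rw [Complex.I_sq]; ring, Complex.norm_exp_ofReal]
    rcases hx.eq_or_lt with h0 | hpos
    · rw [← h0]; simp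
    · calc ‖eulerTail m (x * I)‖ * Real.exp (-(π * x))
          ≤ Real.sinh (π * x) / (π * x) * Real.exp (-(π * x)) :=
            mul_le_mul_of_nonneg_right (norm_eulerTail_mul_I_le m hpos.ne') (Real.exp_pos _).le
        _ ≤ 1 := sinh_div_mul_exp_neg_le_one hpos
  show ‖h z‖ ≤ 1
  rcases le_total 0 z.re with hre0 | hre0
  · exact PhragmenLindelof.quadrant_I (f := h) hdiff.diffContOnCl (hB _) (fun x _ => hre x) him hre0 hz
  · exact PhragmenLindelof.quadrant_II (f := h) hdiff.diffContOnCl (hB _) (fun x _ => hre x) him hre0 hz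

/-- **Uniform exponential-type bound for the Euler tail products**:
`‖∏_{l>m} (1 - y²/l²)‖ ≤ e^{π |Im y|}` for all `m` and all `y ∈ ℂ`. [folklore] -/
theorem norm_eulerTail_le (m : ℕ) (y : ℂ) : ‖eulerTail m y‖ ≤ Real.exp (π * |y.im|) := by
  wlog hy : 0 ≤ y.im generalizing y
  · have := this (-y) (by simp; linarith)
    rwa [eulerTail_neg, Complex.neg_im, abs_neg] at this
  rw [abs_of_nonneg hy]
  have h := norm_eulerTail_mul_exp_le_one m hy
  rw [norm_mul, Complex.norm_exp] at h
  have he : (I * (π : ℂ) * y).re = -(π * y.im) := by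
    simp [Complex.mul_re, Complex.mul_im]
  rw [he] at h
  have hpos := Real.exp_pos (-(π * y.im))
  calc ‖eulerTail m y‖ = ‖eulerTail m y‖ * Real.exp (-(π * y.im)) * Real.exp (π * y.im) := by
        rw [mul_assoc, ← Real.exp_add]; simp
    _ ≤ 1 * Real.exp (π * y.im) := by gcongr
    _ = Real.exp (π * y.im) := one_mul _

end Zagier2012


end Literature.NumberTheory.Transcendental
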